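import Summits.HubbardSuperconductivity.HubbardSuperconductivity.Theorems.AnisotropyChordDoobJohnsonChordPerronFamily

/-!
# Route `AnisotropyChord`, crux `ChordXY` (stmt-HubbardSuperconductivity-8146), line `doob-johnson-chord`:
# FIRST-ORDER PERTURBATION THEORY along a smooth Perron family of the half-filled sector — Hellmann–Feynman
# for the sector energy, the linear-response equation for `∂_u ψ_u`, and the resolvent form of the
# log-slope quantity (lead-8146-chordxy g1)

Vocabulary of `…Theorems.AnisotropyChordDoobJohnsonChordDefs`; `ι_M = {σ // Σ_z σ_z = M²/2}` the
half-filled configurations, `T_u = (Re H_M(u)_{st})_{s,t ∈ ι_M}` the real sector block,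
`T' = (Re (H_M(1) - H_M(0))_{st})` its (constant) `u`-derivative (`= -Σ SᶻSᶻ` block for `J = -1`),
`E_M(u) = lowestEnergyInSector 1 (H_M(u)) 0`, `Oᵣ = (Re O_{στ})`.  For a `C^∞` family `Ψ` of real
normalised sector ground states (which exists, `exists_smooth_perronFamily`) and `N u = Ψ u|ι_M`,
`N' = (∂_u Ψ u)|ι_M`:

* `sectorBlock_eigen_of_isGS`, `sectorBlock_unit_of_isGS` — `T_u N u = E_M(u) N u`, `‖N u‖ = 1`;
* `hasDerivAt_sectorEnergy_hellmannFeynman` — **Hellmann–Feynman**: `E_M'(u) = ⟨N u, T' N u⟩`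
  (`= -⟨ψ_u, Σ SᶻSᶻ ψ_u⟩`);
* `firstOrder_perronFamily` — **the linear-response equation**: `(T_u - E_M(u)) N' = (E_M'(u) - T') N u`
  and `N' ⊥ N u` (so `N' = R_u D̃ ψ_u` with `R_u` the reduced resolvent — uniquely, by the gap,
  `PerronBranch.gap_linearization_injective`);
* `deriv_lam_perronFamily` — `d/du Λ(Ψ u) = 2⟨∂_uΨ u, Oᵣ Ψ u⟩`; hence the registered stub
  `stub_logSlopeBound` reads, at each `u ∈ (-1,0)`: `2(1+u)⟨N', Oᵣ N u⟩ ≤ ⟨N u, Oᵣ N u⟩` with `N'` THE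
  solution of the linear-response equation — the cross-susceptibility form `2(1+u)⟨D̃ψ_u, R_u Ō ψ_u⟩ ≤ Λ_M(u)`
  (`logSlope_quantity_eq`).

Folklore (Kato II-§2, §5.4) + bookkeeping on the landed `PerronBranch` identities; no definition; sorry-free.
HONEST: identities only; nothing here proves `stub_logSlopeBound` or `ChordXY`; superconductivity in the
Hubbard model is not advanced.
-/

set_option linter.dupNamespace false

noncomputable section

namespace Summit.HubbardSuperconductivity.HubbardSuperconductivity.Theorems.AnisotropyChord.DoobJohnsonChord

open Matrix Finset
open scoped ContDiff
open Literature.MathematicalPhysics.QuantumLattice Literature.Probability.LatticeModels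
open Summit.HubbardSuperconductivity.HubbardSuperconductivity.Theorems.AnisotropyChord.PerronBranch

variable (M : ℕ) [NeZero M]

/-! ### The block data of a sector ground state -/

/-- A real amplitude in the sector is the zero-extension of its restriction to the half-filled
configurations. [bookkeeping] -/
theorem eq_extend_restrict (hM : Even M) {ψ : Config M → ℝ}
    (hmem : ofReal M ψ ∈ spinZSector (Λ := TorusSite 2 M) 1 0) :
    ψ = fun σ => if h : (∑ z, (σ z : ℕ)) = M ^ 2 / 2 then
      (fun s : {σ : Config M // (∑ z, (σ z : ℕ)) = M ^ 2 / 2} => ψ s.1) ⟨σ, h⟩ else 0 := by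
  funext σ
  by_cases h : (∑ z, (σ z : ℕ)) = M ^ 2 / 2
  · rw [dif_pos h]
  · rw [dif_neg h]
    have h0 := (mem_sector_iff_weight M hM _).1 hmem σ h
    simpa [ofReal] using h0

/-- **Block eigen-equation of a sector ground state**: `T_u (ψ|ι) = E_M(u) (ψ|ι)`. [bookkeeping] -/
theorem sectorBlock_eigen_of_isGS (hM : Even M) {ψ : Config M → ℝ} (u : ℝ)
    (hGS : IsGS M u (ofReal M ψ)) :
    (Matrix.of fun s t : {σ : Config M // (∑ z, (σ z : ℕ)) = M ^ 2 / 2} => (Hxxz M u s.1 t.1).re) *ᵥ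
        (fun s => ψ s.1) =
      lowestEnergyInSector 1 (Hxxz M u) 0 • (fun s => ψ s.1) := by
  have hext := eq_extend_restrict M hM hGS.1
  funext s
  have h1 := mulVec_extend_re M u (fun s : {σ : Config M // (∑ z, (σ z : ℕ)) = M ^ 2 / 2} => ψ s.1) s
  rw [← hext, hGS.2.2, Pi.smul_apply, smul_eq_mul] at h1
  have h2 : ((lowestEnergyInSector 1 (Hxxz M u) 0 : ℝ) : ℂ) * ofReal M ψ s.1 =
      (((lowestEnergyInSector 1 (Hxxz M u) 0 * ψ s.1 : ℝ)) : ℂ) := by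
    simp [ofReal]
  rw [h2] at h1
  have h3 := Complex.ofReal_injective h1
  rw [Pi.smul_apply, smul_eq_mul, ← h3]

/-- **Unit norm of the block vector of a sector ground state**: `‖ψ|ι‖ = 1`. [bookkeeping] -/
theorem sectorBlock_unit_of_isGS (hM : Even M) {ψ : Config M → ℝ} (u : ℝ)
    (hGS : IsGS M u (ofReal M ψ)) :
    (fun s : {σ : Config M // (∑ z, (σ z : ℕ)) = M ^ 2 / 2} => ψ s.1) ⬝ᵥ (fun s => ψ s.1) = 1 := by
  have hext := eq_extend_restrict M hM hGS.1
  have h1 := star_extend_dotProduct_extend M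
    (fun s : {σ : Config M // (∑ z, (σ z : ℕ)) = M ^ 2 / 2} => ψ s.1)
  rw [← hext, hGS.2.1] at h1
  exact_mod_cast h1.symm

/-- The block entries are differentiable in `u` with the constant derivative `Re (H_M(1) - H_M(0))_{στ}`.
[folklore] -/
theorem sectorBlock_hasDerivAt (u : ℝ) (σ τ : Config M) :
    HasDerivAt (fun v : ℝ => (Hxxz M v σ τ).re) ((Hxxz M 1 σ τ).re - (Hxxz M 0 σ τ).re) u := by
  have h : (fun v : ℝ => (Hxxz M v σ τ).re) =
      fun v => (Hxxz M 0 σ τ).re + v * ((Hxxz M 1 σ τ).re - (Hxxz M 0 σ τ).re) :=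
    funext fun v => hxxz_re_affine M v σ τ
  rw [h]
  simpa using ((hasDerivAt_id u).mul_const ((Hxxz M 1 σ τ).re - (Hxxz M 0 σ τ).re)).const_add
    ((Hxxz M 0 σ τ).re)

/-! ### Hellmann–Feynman and the linear-response equation -/

/-- **Hellmann–Feynman for the sector energy along a smooth Perron family**:
`E_M'(u) = ⟨Ψ u|ι, T' Ψ u|ι⟩ = Re⟨ψ_u, (H_M(1) - H_M(0)) ψ_u⟩`. [cite: Kato1966, II-§5.4 Thm 5.4] [folklore] -/
theorem hasDerivAt_sectorEnergy_hellmannFeynman (hM : Even M) {Ψ : ℝ → Config M → ℝ}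
    (hΨ : ContDiff ℝ ∞ Ψ) (hGS : ∀ u, IsGS M u (ofReal M (Ψ u))) (u : ℝ) :
    HasDerivAt (fun v => lowestEnergyInSector 1 (Hxxz M v) 0)
      ((fun s : {σ : Config M // (∑ z, (σ z : ℕ)) = M ^ 2 / 2} => Ψ u s.1) ⬝ᵥ
        (Matrix.of fun s t : {σ : Config M // (∑ z, (σ z : ℕ)) = M ^ 2 / 2} =>
          ((Hxxz M 1 s.1 t.1).re - (Hxxz M 0 s.1 t.1).re)) *ᵥ (fun s => Ψ u s.1)) u := by
  have hΨd : HasDerivAt Ψ (deriv Ψ u) u := (hΨ.differentiable (by simp) u).hasDerivAt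
  have hNd : HasDerivAt (fun v (s : {σ : Config M // (∑ z, (σ z : ℕ)) = M ^ 2 / 2}) => Ψ v s.1)
      (fun s => deriv Ψ u s.1) u :=
    hasDerivAt_pi.2 fun s => (hasDerivAt_pi.1 hΨd) s.1
  have hT : ∀ s t : {σ : Config M // (∑ z, (σ z : ℕ)) = M ^ 2 / 2},
      HasDerivAt (fun v => (Matrix.of fun s t : {σ : Config M // (∑ z, (σ z : ℕ)) = M ^ 2 / 2} =>
        (Hxxz M v s.1 t.1).re) s t)
        ((Matrix.of fun s t : {σ : Config M // (∑ z, (σ z : ℕ)) = M ^ 2 / 2} =>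
          ((Hxxz M 1 s.1 t.1).re - (Hxxz M 0 s.1 t.1).re)) s t) u :=
    fun s t => sectorBlock_hasDerivAt M u s.1 t.1
  have heig : ∀ v, (fun v => Matrix.of fun s t : {σ : Config M // (∑ z, (σ z : ℕ)) = M ^ 2 / 2} =>
      (Hxxz M v s.1 t.1).re) v *ᵥ (fun v (s : {σ : Config M // (∑ z, (σ z : ℕ)) = M ^ 2 / 2}) => Ψ v s.1) v =
      (fun v => lowestEnergyInSector 1 (Hxxz M v) 0) v •
        (fun v (s : {σ : Config M // (∑ z, (σ z : ℕ)) = M ^ 2 / 2}) => Ψ v s.1) v :=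
    fun v => sectorBlock_eigen_of_isGS M hM v (hGS v)
  have hunit : ∀ v, (fun v (s : {σ : Config M // (∑ z, (σ z : ℕ)) = M ^ 2 / 2}) => Ψ v s.1) v ⬝ᵥ
      (fun v (s : {σ : Config M // (∑ z, (σ z : ℕ)) = M ^ 2 / 2}) => Ψ v s.1) v = 1 :=
    fun v => sectorBlock_unit_of_isGS M hM v (hGS v)
  -- `E = ⟨N, T N⟩` is differentiable by the product rule; Hellmann–Feynman identifies the derivative
  have hprod := hasDerivAt_dotProduct_mulVec hNd hNd hT
  have hEfun : (fun v => (fun v (s : {σ : Config M // (∑ z, (σ z : ℕ)) = M ^ 2 / 2}) => Ψ v s.1) v ⬝ᵥ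
      (fun v => Matrix.of fun s t : {σ : Config M // (∑ z, (σ z : ℕ)) = M ^ 2 / 2} =>
        (Hxxz M v s.1 t.1).re) v *ᵥ (fun v (s : {σ : Config M // (∑ z, (σ z : ℕ)) = M ^ 2 / 2}) => Ψ v s.1) v) =
      fun v => lowestEnergyInSector 1 (Hxxz M v) 0 := by
    funext v
    have h1 := heig v
    have h2 := hunit v
    simp only at h1 h2 ⊢
    rw [h1, dotProduct_smul, h2, smul_eq_mul, mul_one]
  rw [hEfun] at hprod
  have hHF := hasDerivAt_eigenvalue_eq_hellmannFeynman hT (sectorBlock_isSymm M u) hNd hprod hunit heig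
  rw [← hHF]
  exact hprod

/-- **The linear-response (first-order perturbation) equation along a smooth Perron family**:
with `N u = Ψ u|ι`, `N' = (∂_uΨ u)|ι`, `E' = E_M'(u) = ⟨N u, T' N u⟩`:
`T_u N' - E_M(u) N' = E' N u - T' N u` and `⟨N', N u⟩ = 0`.  By the gap the pair determines `N'`
(`PerronBranch.gap_linearization_injective`): `∂_u ψ_u = R_u D̃ ψ_u`. [cite: Kato1966, II-§2.2 (2.14)] [folklore] -/
theorem firstOrder_perronFamily (hM : Even M) {Ψ : ℝ → Config M → ℝ}
    (hΨ : ContDiff ℝ ∞ Ψ) (hGS : ∀ u, IsGS M u (ofReal M (Ψ u))) (u : ℝ) :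
    (Matrix.of fun s t : {σ : Config M // (∑ z, (σ z : ℕ)) = M ^ 2 / 2} => (Hxxz M u s.1 t.1).re) *ᵥ
          (fun s => deriv Ψ u s.1) -
        lowestEnergyInSector 1 (Hxxz M u) 0 • (fun s => deriv Ψ u s.1) =
      ((fun s : {σ : Config M // (∑ z, (σ z : ℕ)) = M ^ 2 / 2} => Ψ u s.1) ⬝ᵥ
          (Matrix.of fun s t : {σ : Config M // (∑ z, (σ z : ℕ)) = M ^ 2 / 2} =>
            ((Hxxz M 1 s.1 t.1).re - (Hxxz M 0 s.1 t.1).re)) *ᵥ (fun s => Ψ u s.1)) •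
          (fun s : {σ : Config M // (∑ z, (σ z : ℕ)) = M ^ 2 / 2} => Ψ u s.1) -
        (Matrix.of fun s t : {σ : Config M // (∑ z, (σ z : ℕ)) = M ^ 2 / 2} =>
          ((Hxxz M 1 s.1 t.1).re - (Hxxz M 0 s.1 t.1).re)) *ᵥ (fun s => Ψ u s.1) ∧
    (fun s : {σ : Config M // (∑ z, (σ z : ℕ)) = M ^ 2 / 2} => deriv Ψ u s.1) ⬝ᵥ (fun s => Ψ u s.1) = 0 := by
  have hΨd : HasDerivAt Ψ (deriv Ψ u) u := (hΨ.differentiable (by simp) u).hasDerivAt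
  have hNd : HasDerivAt (fun v (s : {σ : Config M // (∑ z, (σ z : ℕ)) = M ^ 2 / 2}) => Ψ v s.1)
      (fun s => deriv Ψ u s.1) u :=
    hasDerivAt_pi.2 fun s => (hasDerivAt_pi.1 hΨd) s.1
  have hT : ∀ s t : {σ : Config M // (∑ z, (σ z : ℕ)) = M ^ 2 / 2},
      HasDerivAt (fun v => (Matrix.of fun s t : {σ : Config M // (∑ z, (σ z : ℕ)) = M ^ 2 / 2} =>
        (Hxxz M v s.1 t.1).re) s t)
        ((Matrix.of fun s t : {σ : Config M // (∑ z, (σ z : ℕ)) = M ^ 2 / 2} =>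
          ((Hxxz M 1 s.1 t.1).re - (Hxxz M 0 s.1 t.1).re)) s t) u :=
    fun s t => sectorBlock_hasDerivAt M u s.1 t.1
  have heig : ∀ v, (fun v => Matrix.of fun s t : {σ : Config M // (∑ z, (σ z : ℕ)) = M ^ 2 / 2} =>
      (Hxxz M v s.1 t.1).re) v *ᵥ (fun v (s : {σ : Config M // (∑ z, (σ z : ℕ)) = M ^ 2 / 2}) => Ψ v s.1) v =
      (fun v => lowestEnergyInSector 1 (Hxxz M v) 0) v •
        (fun v (s : {σ : Config M // (∑ z, (σ z : ℕ)) = M ^ 2 / 2}) => Ψ v s.1) v :=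
    fun v => sectorBlock_eigen_of_isGS M hM v (hGS v)
  have hunit : ∀ v, (fun v (s : {σ : Config M // (∑ z, (σ z : ℕ)) = M ^ 2 / 2}) => Ψ v s.1) v ⬝ᵥ
      (fun v (s : {σ : Config M // (∑ z, (σ z : ℕ)) = M ^ 2 / 2}) => Ψ v s.1) v = 1 :=
    fun v => sectorBlock_unit_of_isGS M hM v (hGS v)
  have hE := hasDerivAt_sectorEnergy_hellmannFeynman M hM hΨ hGS u
  have key1 := firstOrder_eigenvector_equation hT hNd hE heig
  have key2 := deriv_eigenvector_orthogonal hNd hunit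
  exact ⟨key1, key2⟩

/-! ### The log-slope quantity in linear-response form -/

/-- `d/du Λ(Ψ u) = 2⟨∂_uΨ u, Oᵣ Ψ u⟩` along a `C^∞` family. [folklore] -/
theorem deriv_lam_perronFamily {Ψ : ℝ → Config M → ℝ} (hΨ : ContDiff ℝ ∞ Ψ) (u : ℝ) :
    deriv (fun v => lam M (ofReal M (Ψ v))) u =
      2 * (deriv Ψ u ⬝ᵥ (Matrix.of fun σ τ : Config M => (Otot M σ τ).re) *ᵥ Ψ u) :=
  (hasDerivAt_lam_family M ((hΨ.differentiable (by simp) u).hasDerivAt)).deriv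

/-- **The log-slope quantity of the registered stub in linear-response form**: along a `C^∞` Perron
family, `(1+u) · d/du Λ(Ψ u) = 2(1+u)⟨∂_uΨ u, Oᵣ Ψ u⟩`, where `∂_uΨ u` (restricted to the sector)
is the solution of the linear-response equation of `firstOrder_perronFamily` — i.e. the stub
`stub_logSlopeBound` asks for `2(1+u)⟨D̃ψ_u, R_u Ō ψ_u⟩ ≤ Λ_M(u)` on `(-1,0)`. [bookkeeping] -/
theorem logSlope_quantity_eq {Ψ : ℝ → Config M → ℝ} (hΨ : ContDiff ℝ ∞ Ψ) (u : ℝ) :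
    (1 + u) * deriv (fun v => lam M (ofReal M (Ψ v))) u =
      2 * (1 + u) * (deriv Ψ u ⬝ᵥ (Matrix.of fun σ τ : Config M => (Otot M σ τ).re) *ᵥ Ψ u) := by
  rw [deriv_lam_perronFamily M hΨ u]
  ring

end Summit.HubbardSuperconductivity.HubbardSuperconductivity.Theorems.AnisotropyChord.DoobJohnsonChord

end
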